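import Literature.Probability.RandomPlanarGeometry.HexSAWPolygonCellsStickDecomp
import Literature.Probability.RandomPlanarGeometry.HexSAWPolygonCellsDiag
import Literature.Probability.RandomPlanarGeometry.HexSAWPolygonCellsPolygonMoves
import HarnessLib

/-!
# Cell calculus for honeycomb polygon surgery, XXII: the recursive map «OMEGA» (peel a spike, map the rest, re-grow the spike at the port of its
# support) and THEOREM V by induction — perimeter `+2` and polygonality, from a port invariant of the base

Topic `Literature/Probability/RandomPlanarGeometry` (lane «pcv-sawmu», a-p4 g22; sequel of VI `…CellsPeel` (`peel`, `Peelable`), VII `…CellsHostTransfer`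
(CLAIM H), X/XII `…CellsSticks`/`…CellsStickDecomp` (`urIter`, the peeled part), VIII `…CellsDiag` (`diag`), XIX `…CellsPolygonMoves` (`isPolygon_bdry_insert`)).

The step-two injection «OMEGA» of `HOME/pub-sawmu-a-p4/g21/omega/THEOREM-OMEGA-g21.md` in its RECURSIVE form (DESIGN-OMEGA §1, rule REC): for a set
`S` with peelable top `m` (an up-right spike on `d = LL m`), `ι(S) = ι(S − m) + P_{S−m}(d)` and the port function is transported by
`P_S(m) = UR (P_{S−m}(d))`, `P_S = P_{S−m}` elsewhere; on a base `B` (no peelable top) `ι(B) = C(B)` and `P_B` = the port table.  This file is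
PARAMETRIC in the base data `C`, `P₀` (supplied per base type by the sequels) and proves the induction once and for all:

* `omegaRec C P₀ S` — the pair `(ι S, P_S)` by well-founded recursion on `#S` (as `peel`); `omegaRec_eq_of_peelable`, `omegaRec_eq_base`.
* `PortInv T W P` — the invariant «every host `h` of `T` has a port `P h` that is a clean leaf spot of `W` with a clear up-right ray above it, and distinct
  hosts' ports lie on UR-diagonals `≥ 4` apart» ((P1)–(P3) of LEMMA P, in the form that survives re-growing); ★ `PortInv.step` — it passes from
  `(S − m, W, P)` to `(S, W + P d, P[m ↦ UR (P d)])` (CLAIM H gives the hosts of `S`).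
* ★ `portInv_omegaRec`, ★ `perim_omegaRec : perim (ι S) = perim (C (peel S)) + 4 · #(S ∖ peel S)` — hence `perim (ι S) = perim S + 2` as soon as
  `perim (C B) = perim B + 2` (`perim_omegaRec_eq_add_two`, with VI's `perim_eq_perim_peel_add`), ★ `isPolygon_bdry_omegaRec` — `bdry (ι S)` is a
  honeycomb polygon as soon as `bdry (C B)` is (each re-grown hexagon has a single contact: XIX), `card_omegaRec`.

Sources: N. Madras, G. Slade, *The Self-Avoiding Walk* (1993), §3.2, proof of Theorem 3.2.3 pp. 64–65 (the surgery at the lexicographically largest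
point; here iterated along the stack of extremal units) [MadrasSlade1993]; I. Jensen, J. Phys.: Conf. Ser. 42 (2006) 163 [Jensen2006HoneycombPolygons].
Label (lane): LANE INFRASTRUCTURE for an open combinatorial item (`q_N(ℍ) ≤ q_{N+2}(ℍ)`, even `N ≥ 12`); NEW IN WRITING: the recursive injection itself
(lane result, a-p4 g21), not a literature claim.
-/

open Finset Literature.Probability.LatticeModels

namespace Literature.Probability.RandomPlanarGeometry.SAW

namespace HexCell

/-! ### Small geometry: UR-iterates, diagonals, neighbours -/

/-- `UR^j (UR p) = UR^{j+1} p`. [cite: MadrasSlade1993, §3.2 (proof of Theorem 3.2.3)] -/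
theorem urIter_ur (p : Cell) (j : ℕ) : urIter (UR p) j = urIter p (j + 1) := by
  ext <;> simp [urIter, UR] <;> ring

/-- `UR`-iterates stay on the diagonal. [cite: Jensen2006HoneycombPolygons, §2] -/
theorem diag_urIter (p : Cell) (j : ℕ) : diag (urIter p j) = diag p := by
  simp [diag, urIter]

/-- Neighbours differ in diagonal index by at most `2`. [cite: Jensen2006HoneycombPolygons, §2] -/
theorem abs_diag_sub_le_two_of_mem_nbrs {c d : Cell} (h : d ∈ nbrs c) : |diag d - diag c| ≤ 2 := by
  obtain ⟨x, y⟩ := c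
  simp only [mem_nbrs_iff] at h
  rw [abs_le]
  rcases h with rfl | rfl | rfl | rfl | rfl | rfl <;> simp [diag] <;> omega

/-- Hexagons whose diagonals are `≥ 4` apart are neither equal nor neighbours. [cite: Jensen2006HoneycombPolygons, §2] -/
theorem not_mem_nbrs_of_diag_gap {c d : Cell} (h : 4 ≤ |diag d - diag c|) : d ∉ nbrs c := fun hd => by
  have := abs_diag_sub_le_two_of_mem_nbrs hd; omega

/-- [cite: Jensen2006HoneycombPolygons, §2] -/
theorem ne_of_diag_gap {c d : Cell} (h : 4 ≤ |diag d - diag c|) : d ≠ c := fun e => by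
  subst e; simp at h

/-- Two hexagons on one diagonal are neighbours iff they are consecutive. [cite: Jensen2006HoneycombPolygons, §2] -/
theorem urIter_mem_nbrs_urIter_iff (p : Cell) (i k : ℕ) : urIter p i ∈ nbrs (urIter p k) ↔ i = k + 1 ∨ k = i + 1 := by
  simp only [mem_nbrs_iff, urIter, Prod.mk.injEq]
  omega

/-- A spike on a brick is a brick. [cite: EntingJensen2009, §7.4.2] -/
theorem even_ur {c : Cell} (h : Even (c.1 + c.2)) : Even ((UR c).1 + (UR c).2) := by
  simp only [UR_fst, UR_snd]
  have : c.1 + 1 + (c.2 + 1) = c.1 + c.2 + 2 := by ring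
  rw [this]; exact h.add (by decide)

/-! ### The recursion -/

open Classical in
/-- **OMEGA, recursive form** `(ι S, P_S)`, parametrised by the base image `C` and base port table `P₀`: peel the peelable top `m`, map the rest, re-grow
`m` at the port of its support `LL m`, and transport the port function (`P_S m = UR (P_{S−m} (LL m))`).
[cite: MadrasSlade1993, §3.2, Theorem 3.2.3 (3.2.3) and its proof (transplanted to `ℍ` and iterated)] -/
noncomputable def omegaRec (C : Finset Cell → Finset Cell) (P₀ : Finset Cell → Cell → Cell) (S : Finset Cell) : Finset Cell × (Cell → Cell) :=
  if h : ∃ m, Peelable S m then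
    have : #(S.erase (Classical.choose h)) < #S := card_erase_lt_of_mem (Classical.choose_spec h).mem
    (insert ((omegaRec C P₀ (S.erase (Classical.choose h))).2 (LL (Classical.choose h))) (omegaRec C P₀ (S.erase (Classical.choose h))).1,
      Function.update (omegaRec C P₀ (S.erase (Classical.choose h))).2 (Classical.choose h)
        (UR ((omegaRec C P₀ (S.erase (Classical.choose h))).2 (LL (Classical.choose h)))))
  else (C S, P₀ S)
termination_by #S

variable {C : Finset Cell → Finset Cell} {P₀ : Finset Cell → Cell → Cell}

open Classical in
/-- One step of the recursion. [cite: MadrasSlade1993, §3.2 (proof of Theorem 3.2.3)] -/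
theorem omegaRec_eq_of_peelable {S : Finset Cell} {m : Cell} (hm : Peelable S m) :
    omegaRec C P₀ S = (insert ((omegaRec C P₀ (S.erase m)).2 (LL m)) (omegaRec C P₀ (S.erase m)).1,
      Function.update (omegaRec C P₀ (S.erase m)).2 m (UR ((omegaRec C P₀ (S.erase m)).2 (LL m)))) := by
  have hex : ∃ m, Peelable S m := ⟨m, hm⟩
  have e : Classical.choose hex = m := (Classical.choose_spec hex).unique hm
  rw [omegaRec, dif_pos hex]
  simp only [e]

open Classical in
/-- On a base the recursion returns the base data. [cite: MadrasSlade1993, §3.2 (proof of Theorem 3.2.3)] -/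
theorem omegaRec_eq_base {S : Finset Cell} (h : ¬ ∃ m, Peelable S m) : omegaRec C P₀ S = (C S, P₀ S) := by
  rw [omegaRec, dif_neg h]

/-! ### The port invariant -/

/-- **Port invariant** for `(T, W, P)` with exceptional hosts `X` (the hosts that can never carry a spike, e.g. the last run hexagon of a type-R base):
`T`, `W` are brick sets and every host `h ∉ X` of `T` has a brick port `P h` with (P1) `P h ∉ W` and exactly one contact in `W`, (P2) the up-right ray above
`P h` misses `W` and touches it nowhere, (P3) distinct hosts' ports on UR-diagonals `≥ 4` apart.
[cite: MadrasSlade1993, §3.2 (proof of Theorem 3.2.3: the units are re-attached at clean spots of the image)] -/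
structure PortInv (X T W : Finset Cell) (P : Cell → Cell) : Prop where
  brickT : IsBrickSet T
  brickW : IsBrickSet W
  brickP : ∀ ⦃h⦄, IsHost T h → h ∉ X → Even ((P h).1 + (P h).2)
  notMem : ∀ ⦃h⦄, IsHost T h → h ∉ X → ∀ j : ℕ, urIter (P h) j ∉ W
  one : ∀ ⦃h⦄, IsHost T h → h ∉ X → #(nbrs (P h) ∩ W) = 1
  clear : ∀ ⦃h⦄, IsHost T h → h ∉ X → ∀ j : ℕ, 1 ≤ j → ∀ c ∈ W, c ∉ nbrs (urIter (P h) j)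
  sep : ∀ ⦃h h'⦄, IsHost T h → h ∉ X → IsHost T h' → h' ∉ X → h ≠ h' → 4 ≤ |diag (P h) - diag (P h')|

/-- ★ **The invariant survives one step of OMEGA**: from `(S − m, W, P)` to `(S, W + P (LL m), P[m ↦ UR (P (LL m))])` for a spike top `m` of the brick set `S`.
[cite: MadrasSlade1993, §3.2 (proof of Theorem 3.2.3)] -/
theorem PortInv.step {X S : Finset Cell} {m : Cell} (hm : IsSpikeTop S m) (hmb : Even (m.1 + m.2)) (hdX : LL m ∉ X) {W : Finset Cell}
    {P : Cell → Cell} (hI : PortInv X (S.erase m) W P) :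
    PortInv X S (insert (P (LL m)) W) (Function.update P m (UR (P (LL m)))) := by
  have hd : IsHost (S.erase m) (LL m) := isHost_erase_ll_of_isSpikeTop hm
  -- hosts of `S` other than `m` are hosts of `S.erase m` different from `LL m`
  have hother : ∀ {h}, IsHost S h → h ≠ m → IsHost (S.erase m) h ∧ h ≠ LL m := by
    intro h hh hne
    refine ⟨hh.erase_of_ne hm hne, fun e => ?_⟩
    subst e
    have := ((isHost_iff_isHost_erase hm hne).1 hh).2
    simp at this
  have hsep_d : ∀ {h}, IsHost (S.erase m) h → h ∉ X → h ≠ LL m → 4 ≤ |diag (P (LL m)) - diag (P h)| :=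
    fun hh hX hne => hI.sep hd hdX hh hX (Ne.symm hne)
  refine ⟨?_, ?_, ?_, ?_, ?_, ?_, ?_⟩
  · -- bricks
    intro c hc
    by_cases hcm : c = m
    · subst hcm; exact hmb
    · exact hI.brickT c (mem_erase.2 ⟨hcm, hc⟩)
  · intro c hc
    rcases mem_insert.1 hc with rfl | hc
    · exact hI.brickP hd hdX
    · exact hI.brickW c hc
  · intro h hh hX
    by_cases hhm : h = m
    · subst hhm; rw [Function.update_self]; exact even_ur (hI.brickP hd hdX)
    · rw [Function.update_of_ne hhm]; exact hI.brickP (hother hh hhm).1 hX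
  · intro h hh hX j
    by_cases hhm : h = m
    · subst hhm
      rw [Function.update_self, urIter_ur, mem_insert, not_or]
      refine ⟨fun e => ?_, hI.notMem hd hdX (j + 1)⟩
      have := congrArg Prod.snd e; simp [urIter] at this; omega
    · obtain ⟨hh', hne⟩ := hother hh hhm
      rw [Function.update_of_ne hhm, mem_insert, not_or]
      refine ⟨fun e => ?_, hI.notMem hh' hX j⟩
      have hgap := hsep_d hh' hX hne
      rw [← e, diag_urIter] at hgap
      simp at hgap
  · intro h hh hX
    by_cases hhm : h = m
    · subst hhm
      rw [Function.update_self]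
      have e : nbrs (UR (P (LL h))) ∩ insert (P (LL h)) W = {P (LL h)} := by
        ext c
        simp only [mem_inter, mem_insert, mem_singleton]
        constructor
        · rintro ⟨hc, rfl | hcW⟩
          · rfl
          · exfalso
            have := hI.clear hd hdX 1 le_rfl c hcW
            rw [show urIter (P (LL h)) 1 = UR (P (LL h)) by rw [← urIter_ur]; simp] at this
            exact this hc
        · rintro rfl
          refine ⟨?_, Or.inl rfl⟩
          have := (urIter_mem_nbrs_urIter_iff (P (LL h)) 0 1).2 (Or.inr rfl)
          simpa [urIter_succ] using this
      rw [e, card_singleton]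
    · obtain ⟨hh', hne⟩ := hother hh hhm
      rw [Function.update_of_ne hhm]
      have hp : P (LL m) ∉ nbrs (P h) := not_mem_nbrs_of_diag_gap (hsep_d hh' hX hne)
      rw [insert_eq, inter_union_distrib_left, inter_singleton_of_notMem hp, empty_union]
      exact hI.one hh' hX
  · intro h hh hX j hj c hc
    by_cases hhm : h = m
    · subst hhm
      rw [Function.update_self, urIter_ur]
      rcases mem_insert.1 hc with rfl | hcW
      · have key := urIter_mem_nbrs_urIter_iff (P (LL h)) 0 (j + 1)
        rw [urIter_zero] at key
        rw [key]; omega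
      · exact hI.clear hd hdX (j + 1) (by omega) c hcW
    · obtain ⟨hh', hne⟩ := hother hh hhm
      rw [Function.update_of_ne hhm]
      rcases mem_insert.1 hc with rfl | hcW
      · refine not_mem_nbrs_of_diag_gap ?_
        rw [diag_urIter]; exact hsep_d hh' hX hne
      · exact hI.clear hh' hX j hj c hcW
  · intro h h' hh hX hh' hX' hne
    by_cases hhm : h = m
    · subst hhm
      have hh'm : h' ≠ h := Ne.symm hne
      obtain ⟨hh'', hne'⟩ := hother hh' hh'm
      rw [Function.update_self, Function.update_of_ne hh'm, show diag (UR (P (LL h))) = diag (P (LL h)) by simp [diag]]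
      exact hsep_d hh'' hX' hne'
    · by_cases hh'm : h' = m
      · subst hh'm
        obtain ⟨hh'', hne'⟩ := hother hh hhm
        rw [Function.update_self, Function.update_of_ne hhm, show diag (UR (P (LL h'))) = diag (P (LL h')) by simp [diag],
          abs_sub_comm]
        exact hsep_d hh'' hX hne'
      · rw [Function.update_of_ne hhm, Function.update_of_ne hh'm]
        exact hI.sep (hother hh hhm).1 hX (hother hh' hh'm).1 hX' hne

/-! ### THEOREM V by induction along the peeling -/

open Classical in
/-- ★ **The port invariant propagates from the base to `S`.** [cite: MadrasSlade1993, §3.2 (proof of Theorem 3.2.3)] -/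
theorem portInv_omegaRec {X S : Finset Cell} (hS : IsBrickSet S) (hX : ∀ c ∈ S \ peel S, LL c ∉ X)
    (hbase : PortInv X (peel S) (C (peel S)) (P₀ (peel S))) : PortInv X S (omegaRec C P₀ S).1 (omegaRec C P₀ S).2 := by
  induction S using Finset.strongInduction with
  | H S ih =>
    by_cases h : ∃ m, Peelable S m
    · obtain ⟨m, hm⟩ := h
      rw [omegaRec_eq_of_peelable hm]
      have hS' : IsBrickSet (S.erase m) := fun c hc => hS c (mem_of_mem_erase hc)
      have hb' : PortInv X (peel (S.erase m)) (C (peel (S.erase m))) (P₀ (peel (S.erase m))) := by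
        rw [← peel_eq_peel_erase hm]; exact hbase
      have hX' : ∀ c ∈ S.erase m \ peel (S.erase m), LL c ∉ X := fun c hc =>
        hX c (by rw [sdiff_peel_eq_insert hm]; exact mem_insert_of_mem hc)
      have hmX : LL m ∉ X := hX m (by rw [sdiff_peel_eq_insert hm]; exact mem_insert_self _ _)
      exact (ih _ (erase_ssubset hm.mem) hS' hX' hb').step hm.1 (hS m hm.mem) hmX
    · rw [omegaRec_eq_base h]
      rw [peel_eq_self h] at hbase
      exact hbase

open Classical in
/-- ★ **Perimeter bookkeeping**: `perim (ι S) = perim (C (peel S)) + 4 · #(S ∖ peel S)` — each re-grown hexagon is a new leaf.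
[cite: MadrasSlade1993, §3.2, Theorem 3.2.3 (3.2.3) and its proof (length bookkeeping)] -/
theorem perim_omegaRec {X S : Finset Cell} (hS : IsBrickSet S) (hX : ∀ c ∈ S \ peel S, LL c ∉ X)
    (hbase : PortInv X (peel S) (C (peel S)) (P₀ (peel S))) :
    perim (omegaRec C P₀ S).1 = perim (C (peel S)) + 4 * #(S \ peel S) := by
  induction S using Finset.strongInduction with
  | H S ih =>
    by_cases h : ∃ m, Peelable S m
    · obtain ⟨m, hm⟩ := h
      have hS' : IsBrickSet (S.erase m) := fun c hc => hS c (mem_of_mem_erase hc)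
      have hpe := peel_eq_peel_erase hm
      have hb' : PortInv X (peel (S.erase m)) (C (peel (S.erase m))) (P₀ (peel (S.erase m))) := by rw [← hpe]; exact hbase
      have hX' : ∀ c ∈ S.erase m \ peel (S.erase m), LL c ∉ X := fun c hc =>
        hX c (by rw [sdiff_peel_eq_insert hm]; exact mem_insert_of_mem hc)
      have hmX : LL m ∉ X := hX m (by rw [sdiff_peel_eq_insert hm]; exact mem_insert_self _ _)
      have hI := portInv_omegaRec hS' hX' hb'
      have hd : IsHost (S.erase m) (LL m) := isHost_erase_ll_of_isSpikeTop hm.1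
      rw [omegaRec_eq_of_peelable hm]
      simp only
      rw [perim_insert_of_contacts_eq_one (by simpa using hI.notMem hd hmX 0) (hI.one hd hmX), ih _ (erase_ssubset hm.mem) hS' hX' hb',
        sdiff_peel_eq_insert hm, card_insert_of_notMem (fun hx => (notMem_erase m S) (mem_sdiff.1 hx).1), ← hpe]
      ring
    · rw [omegaRec_eq_base h, peel_eq_self h, _root_.sdiff_self, bot_eq_empty, card_empty, mul_zero, add_zero]

open Classical in
/-- **THEOREM V, perimeter**: if the base image is a `+2` move then `perim (ι S) = perim S + 2`.
[cite: MadrasSlade1993, §3.2, Theorem 3.2.3 (3.2.3) (transplanted to `ℍ`)] -/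
theorem perim_omegaRec_eq_add_two {X S : Finset Cell} (hS : IsBrickSet S) (hX : ∀ c ∈ S \ peel S, LL c ∉ X)
    (hbase : PortInv X (peel S) (C (peel S)) (P₀ (peel S))) (hC : perim (C (peel S)) = perim (peel S) + 2) :
    perim (omegaRec C P₀ S).1 = perim S + 2 := by
  rw [perim_omegaRec hS hX hbase, hC, perim_eq_perim_peel_add S]; ring

open Classical in
/-- The size of the image: `#(ι S) = #(C (peel S)) + #(S ∖ peel S)`. [cite: MadrasSlade1993, §3.2 (proof of Theorem 3.2.3)] -/
theorem card_omegaRec {X S : Finset Cell} (hS : IsBrickSet S) (hX : ∀ c ∈ S \ peel S, LL c ∉ X)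
    (hbase : PortInv X (peel S) (C (peel S)) (P₀ (peel S))) :
    #(omegaRec C P₀ S).1 = #(C (peel S)) + #(S \ peel S) := by
  induction S using Finset.strongInduction with
  | H S ih =>
    by_cases h : ∃ m, Peelable S m
    · obtain ⟨m, hm⟩ := h
      have hS' : IsBrickSet (S.erase m) := fun c hc => hS c (mem_of_mem_erase hc)
      have hpe := peel_eq_peel_erase hm
      have hb' : PortInv X (peel (S.erase m)) (C (peel (S.erase m))) (P₀ (peel (S.erase m))) := by rw [← hpe]; exact hbase
      have hX' : ∀ c ∈ S.erase m \ peel (S.erase m), LL c ∉ X := fun c hc =>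
        hX c (by rw [sdiff_peel_eq_insert hm]; exact mem_insert_of_mem hc)
      have hmX : LL m ∉ X := hX m (by rw [sdiff_peel_eq_insert hm]; exact mem_insert_self _ _)
      have hI := portInv_omegaRec hS' hX' hb'
      have hd : IsHost (S.erase m) (LL m) := isHost_erase_ll_of_isSpikeTop hm.1
      rw [omegaRec_eq_of_peelable hm]
      simp only
      rw [card_insert_of_notMem (by simpa using hI.notMem hd hmX 0), ih _ (erase_ssubset hm.mem) hS' hX' hb', sdiff_peel_eq_insert hm,
        card_insert_of_notMem (fun hx => (notMem_erase m S) (mem_sdiff.1 hx).1), ← hpe]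
      ring
    · rw [omegaRec_eq_base h, peel_eq_self h, _root_.sdiff_self, bot_eq_empty, card_empty, add_zero]

/-! ### THEOREM V, polygonality -/

/-- A honeycomb polygon has at least three bonds. [cite: MadrasSlade1993, Definition 3.2.1 p. 62] -/
theorem three_le_card_of_isPolygon {E : Finset (Sym2 (Site 2))} (hE : IsPolygon brickWallGraph E) : 3 ≤ #E := by
  obtain ⟨u, c, hc, rfl⟩ := hE
  rw [List.toFinset_card_of_nodup hc.edges_nodup, SimpleGraph.Walk.length_edges]
  exact hc.three_le_length

/-- A hexagon with exactly one contact has a contact arc of length one. [cite: MadrasSlade1993, §3.2 (proof of Theorem 3.2.3)] -/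
theorem exists_arc_of_card_contacts_eq_one {W : Finset Cell} {c : Cell} (h : #(nbrs c ∩ W) = 1) :
    ∃ a : ℕ, ∀ i < 6, nbrDir c (a + i) ∈ W ↔ i < 1 := by
  obtain ⟨d, hd⟩ := card_eq_one.1 h
  have hdmem : d ∈ nbrs c ∩ W := by rw [hd]; exact mem_singleton_self d
  obtain ⟨a, ha, hda⟩ := (mem_nbrs_iff_exists_nbrDir 0).1 (mem_inter.1 hdmem).1
  rw [Nat.zero_add] at hda
  refine ⟨a, fun i hi => ?_⟩
  constructor
  · intro hin
    have : nbrDir c (a + i) ∈ nbrs c ∩ W := mem_inter.2 ⟨nbrDir_mem_nbrs c _, hin⟩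
    rw [hd, mem_singleton, hda] at this
    have := nbrDir_injective_mod this
    omega
  · intro hi0
    have : i = 0 := by omega
    subst this
    rw [Nat.add_zero, ← hda]; exact (mem_inter.1 hdmem).2

open Classical in
/-- ★ **THEOREM V, polygonality**: if the base image has a polygonal boundary then so has `ι S` (each re-grown hexagon is a new leaf: part XIX).
[cite: MadrasSlade1993, §3.2, proof of Theorem 3.2.3 pp. 64–65 ("clearly a polygon")] -/
theorem isPolygon_bdry_omegaRec {X S : Finset Cell} (hS : IsBrickSet S) (hX : ∀ c ∈ S \ peel S, LL c ∉ X)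
    (hbase : PortInv X (peel S) (C (peel S)) (P₀ (peel S))) (hpoly : IsPolygon brickWallGraph (bdry (C (peel S)))) :
    IsPolygon brickWallGraph (bdry (omegaRec C P₀ S).1) := by
  induction S using Finset.strongInduction with
  | H S ih =>
    by_cases h : ∃ m, Peelable S m
    · obtain ⟨m, hm⟩ := h
      have hS' : IsBrickSet (S.erase m) := fun c hc => hS c (mem_of_mem_erase hc)
      have hpe := peel_eq_peel_erase hm
      have hb' : PortInv X (peel (S.erase m)) (C (peel (S.erase m))) (P₀ (peel (S.erase m))) := by rw [← hpe]; exact hbase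
      have hX' : ∀ c ∈ S.erase m \ peel (S.erase m), LL c ∉ X := fun c hc =>
        hX c (by rw [sdiff_peel_eq_insert hm]; exact mem_insert_of_mem hc)
      have hmX : LL m ∉ X := hX m (by rw [sdiff_peel_eq_insert hm]; exact mem_insert_self _ _)
      have hp' : IsPolygon brickWallGraph (bdry (C (peel (S.erase m)))) := by rw [← hpe]; exact hpoly
      have hI := portInv_omegaRec hS' hX' hb'
      have hW := ih _ (erase_ssubset hm.mem) hS' hX' hb' hp'
      have hd : IsHost (S.erase m) (LL m) := isHost_erase_ll_of_isSpikeTop hm.1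
      rw [omegaRec_eq_of_peelable hm]
      simp only
      obtain ⟨a, harc⟩ := exists_arc_of_card_contacts_eq_one (hI.one hd hmX)
      have hlt : 1 < perim (omegaRec C P₀ (S.erase m)).1 := by
        rw [← card_bdry hI.brickW]; have := three_le_card_of_isPolygon hW; omega
      exact isPolygon_bdry_insert hI.brickW (hI.brickP hd hmX) (by simpa using hI.notMem hd hmX 0) hW le_rfl (by norm_num) hlt harc
    · rw [omegaRec_eq_base h]
      rw [peel_eq_self h] at hpoly
      exact hpoly

end HexCell

end Literature.Probability.RandomPlanarGeometry.SAW
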